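import Summits.NavierStokesRegularity.NavierStokesRegularity.Theorems.TerminalTraceTypeITraceScarL3ApexPackageTranslate
import Summits.NavierStokesRegularity.NavierStokesRegularity.Theorems.TerminalTraceTypeITraceScarL3StubNoConfinedExtinctApex
import Literature.Analysis.FluidPDE.AncientLimitVanishingScaled
import HarnessLib

/-!
# The LATE SWEEP: an extinct Type-I apex that is a.e. bounded on a late WHOLE-SPACE slab vanishes on a
# late whole-space slab (first half of stub Z1 `stub_lateBoundedLiouville` of the candidate line `radius_dichotomy`,
# item `TerminalTrace.TypeITraceScarL3`, stmt-NavierStokesRegularity-18385)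

Seat nsreg-C26-p1 g5 (cell ns-regularity-ideate), `--supports stmt-NavierStokesRegularity-18385` (helper); memo
`HOME/nsreg-C26-p1-LOUD-ZOOM-18385.md`, candidate skeleton `Cruxes/TypeITraceScarL3/Lines/radius_dichotomy_CANDIDATE.lean`.

`lateSweep_ae_zero`: if `(U, P, G)` carries the extinct Type-I apex package of class `(M, D₀, C)` at the origin
(suitable in every `Q(a)`, weak gradient, `𝐈(Q(a)) ≤ M`, `D ≤ D₀` at all apices `≤ 0`, rate `C/√(−s)`, weakly null
top) and `‖U‖ ≤ L` a.e. on the whole-space slab `]−T₁, 0[ × ℝ³`, `T₁ ≥ 2`, `L > 0`, then `U = 0` a.e. on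
`]−(λ/2)², 0[ × ℝ³`, `λ = min(1, 1/L)`.

Proof: at EVERY top apex `(0, x)` the space translate carries the same package (`apexPackage_translate`), the
same far-field bound (Lebesgue measure is translation invariant) and the slice Liouville property (rate ⇒ a.e.
bounded slices, `cknAEss ≤ 𝐈 ≤ M` ⇒ linear growth of ball energies, `harmonic_eq_zero_of_ae_bounded_of_energy_growth`,
word for word as in Stub B `stub_no_confinedExtinctApex`); the tree's ESS endgame
`Literature.Analysis.FluidPDE.ancient_lintegral_cube_eq_zero_of_farField_le` then gives `∫_{Q(λ/2)} |U(·, · + x)|³ = 0`,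
i.e. `U = 0` a.e. on `Q_{λ/2}(0, x)`; a countable dense set of apices `x` covers the slab.
WHAT THIS IS NOT: not yet Z1 (the backward iteration in time is the second half); 18385 / NS regularity NOT proved.
[folklore; EscauriazaSereginSverak2003 Thm 5.1; Seregin2014 §6.6; WangZhang2016 §4]
-/

noncomputable section

set_option linter.dupNamespace false

namespace Summit.NavierStokesRegularity.NavierStokesRegularity.Theorems.TypeITraceScarL3

open MeasureTheory Set Function Filter Topology TopologicalSpace Metric InnerProductSpace
open Literature.Analysis.FluidPDE
open scoped NNReal ENNReal RealInnerProductSpace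

/-- The space translation `(s, y) ↦ (s, y + x)` pulls the parabolic ball `Q_r(0, x)` back to `Q_r(0)`. [folklore] -/
theorem preimage_translate_parabolicCylinder (x : EuclideanSpace ℝ (Fin 3)) (r : ℝ) :
    (fun z : ℝ × EuclideanSpace ℝ (Fin 3) => (z.1, z.2 + -x)) ⁻¹'
        parabolicCylinder r (0 : ℝ × EuclideanSpace ℝ (Fin 3)) =
      parabolicCylinder r (((0 : ℝ), x) : ℝ × EuclideanSpace ℝ (Fin 3)) := by
  ext ⟨s, y⟩
  simp only [mem_preimage, mem_parabolicCylinder, Prod.fst_zero, Prod.snd_zero, dist_zero_right]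
  rw [show y + -x = y - x from (sub_eq_add_neg y x).symm, ← dist_eq_norm]

set_option maxHeartbeats 1600000 in
/-- **The late sweep at one top apex.** Under the extinct Type-I apex package at the origin and an a.e. bound
`‖U‖ ≤ L` on `]−T₁, 0[ × ℝ³` (`T₁ ≥ 2`, `L > 0`), `U = 0` a.e. on the parabolic ball `Q_{λ/2}(0, x)`,
`λ = min(1, 1/L)`, for EVERY `x ∈ ℝ³` (the ESS endgame of the tree applied to the space translate).
[cite: EscauriazaSereginSverak2003, Thm. 5.1] -/
theorem lateSweep_ae_zero_ball
    {U : ℝ → EuclideanSpace ℝ (Fin 3) → EuclideanSpace ℝ (Fin 3)}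
    {P : ℝ → EuclideanSpace ℝ (Fin 3) → ℝ}
    {G : ℝ → EuclideanSpace ℝ (Fin 3) → EuclideanSpace ℝ (Fin 3) →L[ℝ] EuclideanSpace ℝ (Fin 3)}
    {M D₀ : ℝ≥0} {C : ℝ}
    (hsw : ∀ a : ℝ, 0 < a →
      IsSuitableWeakSolutionInBall a (0 : ℝ × EuclideanSpace ℝ (Fin 3)) U P)
    (hG : ∀ a : ℝ, 0 < a →
      HasWeakSpatialGradientOn
        (parabolicCylinderOpens a (0 : ℝ × EuclideanSpace ℝ (Fin 3))) U G)
    (hI : ∀ a : ℝ, 0 < a →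
      typeIBound (parabolicCylinder a (0 : ℝ × EuclideanSpace ℝ (Fin 3))) U P G ≤ M)
    (hD : ∀ z₀ : ℝ × EuclideanSpace ℝ (Fin 3), z₀.1 ≤ 0 →
      ∀ r : ℝ, 0 < r → cknD r z₀ P ≤ D₀)
    (hrate : ∀ s : ℝ, s < 0 →
      ∀ᵐ y : EuclideanSpace ℝ (Fin 3), ‖U s y‖ ≤ C / Real.sqrt (-s))
    (htop : ∀ φ : EuclideanSpace ℝ (Fin 3) → EuclideanSpace ℝ (Fin 3),
      ContDiff ℝ (⊤ : ℕ∞) φ →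
      HasCompactSupport φ → ∀ ε : ℝ, 0 < ε →
      ∃ s₀ : ℝ, s₀ < 0 ∧ ∀ᵐ s ∂(volume.restrict (Ioo s₀ 0)), |∫ y, ⟪U s y, φ y⟫| ≤ ε)
    {L T₁ : ℝ} (hL : 0 < L) (hT₁ : 2 ≤ T₁)
    (hbd : ∀ᵐ z ∂(volume.restrict (Ioo (-T₁) 0 ×ˢ (univ : Set (EuclideanSpace ℝ (Fin 3))))),
      ‖U z.1 z.2‖ ≤ L)
    (x : EuclideanSpace ℝ (Fin 3)) :
    ∀ᵐ z ∂(volume.restrict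
      (parabolicCylinder (min 1 L⁻¹ / 2) (((0 : ℝ), x) : ℝ × EuclideanSpace ℝ (Fin 3)))), U z.1 z.2 = 0 := by
  -- ### the translated package
  obtain ⟨hsw', hG', hI', hD', hrate', htop'⟩ := apexPackage_translate x hsw hG hI hD hrate htop
  set U' : ℝ → EuclideanSpace ℝ (Fin 3) → EuclideanSpace ℝ (Fin 3) := fun s y => U s (y + x) with hU'def
  set P' : ℝ → EuclideanSpace ℝ (Fin 3) → ℝ := fun s y => P s (y + x) with hP'def
  set G' : ℝ → EuclideanSpace ℝ (Fin 3) → EuclideanSpace ℝ (Fin 3) →L[ℝ] EuclideanSpace ℝ (Fin 3) :=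
    fun s y => G s (y + x) with hG'def
  -- (ii) pressure bound for radii `≤ 1`
  have hP'' : ∀ z₀ : ℝ × EuclideanSpace ℝ (Fin 3), z₀.1 ≤ 0 → ∀ r ∈ Ioc (0 : ℝ) 1, cknD r z₀ P' ≤ D₀ :=
    fun z₀ hz₀ r hr => hD' z₀ hz₀ r hr.1
  -- (iv) the far field of the translate
  have hfar' : ∀ᵐ z ∂(volume.restrict
      (Ioo (-T₁) 0 ×ˢ (closedBall (0 : EuclideanSpace ℝ (Fin 3)) 1)ᶜ)), ‖U' z.1 z.2‖ ≤ L := by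
    have hA : MeasurableSet (Ioo (-T₁) (0 : ℝ) ×ˢ (univ : Set (EuclideanSpace ℝ (Fin 3)))) :=
      measurableSet_Ioo.prod MeasurableSet.univ
    have h1 := ae_restrict_comp_translate x hA hbd
    have hsub : Ioo (-T₁) (0 : ℝ) ×ˢ (closedBall (0 : EuclideanSpace ℝ (Fin 3)) 1)ᶜ ⊆
        (fun z : ℝ × EuclideanSpace ℝ (Fin 3) => (z.1, z.2 + x)) ⁻¹'
          (Ioo (-T₁) (0 : ℝ) ×ˢ (univ : Set (EuclideanSpace ℝ (Fin 3)))) :=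
      fun z hz => ⟨hz.1, mem_univ _⟩
    filter_upwards [ae_restrict_of_ae_restrict_of_subset hsub h1] with z hz
    exact hz
  -- (v) the Liouville property of the slices of the translate
  have hA' : ∀ n : ℕ, 1 ≤ n → ∀ᵐ t ∂(volume.restrict (Ioo (-1 : ℝ) 0)),
      ∫⁻ y in ball (0 : EuclideanSpace ℝ (Fin 3)) n, ‖U' t y‖ₑ ^ 2 ≤ (M : ℝ≥0∞) * (n : ℝ≥0∞) := by
    -- adapted from Stub B (`stub_no_confinedExtinctApex`, step (v))
    intro n hn
    have hn0 : (0 : ℝ) < n := by exact_mod_cast hn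
    have hAe : cknAEss n (0 : ℝ × EuclideanSpace ℝ (Fin 3)) U' ≤ M := by
      refine le_trans ?_ (hI' n hn0)
      exact (cknAEss_le_abScaledSum (p := P') (G := G')).trans
        (abScaledSum_le_typeIBound hn0 subset_rfl)
    have h1 : ∀ᵐ t ∂(volume.restrict (Ioo ((0 : ℝ × EuclideanSpace ℝ (Fin 3)).1 - (n : ℝ) ^ 2)
        (0 : ℝ × EuclideanSpace ℝ (Fin 3)).1)),
        (ENNReal.ofReal (n : ℝ))⁻¹ * ∫⁻ y in ball (0 : ℝ × EuclideanSpace ℝ (Fin 3)).2 n, ‖U' t y‖ₑ ^ 2 ≤ M := by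
      have h := ENNReal.ae_le_essSup (μ := volume.restrict (Ioo ((0 : ℝ × EuclideanSpace ℝ (Fin 3)).1 -
          (n : ℝ) ^ 2) (0 : ℝ × EuclideanSpace ℝ (Fin 3)).1))
        (fun t => (ENNReal.ofReal (n : ℝ))⁻¹ * ∫⁻ y in ball (0 : ℝ × EuclideanSpace ℝ (Fin 3)).2 n,
          ‖U' t y‖ₑ ^ 2)
      filter_upwards [h] with t ht
      exact ht.trans hAe
    have hsub : Ioo (-1 : ℝ) 0 ⊆ Ioo ((0 : ℝ × EuclideanSpace ℝ (Fin 3)).1 - (n : ℝ) ^ 2)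
        (0 : ℝ × EuclideanSpace ℝ (Fin 3)).1 := by
      intro t ht
      simp only [Prod.fst_zero, zero_sub, mem_Ioo]
      have : (1 : ℝ) ≤ (n : ℝ) ^ 2 := by
        have h1 : (1 : ℝ) ≤ n := by exact_mod_cast hn
        nlinarith
      exact ⟨by linarith [ht.1], ht.2⟩
    filter_upwards [ae_restrict_of_ae_restrict_of_subset hsub h1] with t ht
    rw [Prod.snd_zero] at ht
    have hn0' : ENNReal.ofReal (n : ℝ) ≠ 0 := (ENNReal.ofReal_pos.2 hn0).ne'
    have hntop : ENNReal.ofReal (n : ℝ) ≠ ⊤ := ENNReal.ofReal_ne_top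
    calc ∫⁻ y in ball (0 : EuclideanSpace ℝ (Fin 3)) n, ‖U' t y‖ₑ ^ 2
        = ENNReal.ofReal (n : ℝ) * ((ENNReal.ofReal (n : ℝ))⁻¹ *
            ∫⁻ y in ball (0 : EuclideanSpace ℝ (Fin 3)) n, ‖U' t y‖ₑ ^ 2) := by
          rw [← mul_assoc, ENNReal.mul_inv_cancel hn0' hntop, one_mul]
      _ ≤ ENNReal.ofReal (n : ℝ) * M := by gcongr
      _ = (M : ℝ≥0∞) * (n : ℝ≥0∞) := by rw [ENNReal.ofReal_natCast, mul_comm]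
  have hL' : ∀ᵐ t ∂(volume.restrict (Ioo (-1 : ℝ) 0)),
      ∀ V : EuclideanSpace ℝ (Fin 3) → EuclideanSpace ℝ (Fin 3),
        HarmonicOnNhd V (univ : Set (EuclideanSpace ℝ (Fin 3))) → V =ᵐ[volume] U' t → V = 0 := by
    have hall : ∀ᵐ t ∂(volume.restrict (Ioo (-1 : ℝ) 0)), ∀ n : ℕ, 1 ≤ n →
        ∫⁻ y in ball (0 : EuclideanSpace ℝ (Fin 3)) n, ‖U' t y‖ₑ ^ 2 ≤ (M : ℝ≥0∞) * (n : ℝ≥0∞) := by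
      rw [ae_all_iff]
      intro n
      by_cases hn : 1 ≤ n
      · filter_upwards [hA' n hn] with t ht _ using ht
      · exact ae_of_all _ fun t h => absurd h hn
    filter_upwards [hall, ae_restrict_mem measurableSet_Ioo] with t ht htI V hV hVU
    exact harmonic_eq_zero_of_ae_bounded_of_energy_growth hV hVU (hrate' t htI.2) ENNReal.coe_ne_top ht
  -- (vi) the ESS endgame for the translate
  have hzero := ancient_lintegral_cube_eq_zero_of_farField_le hsw' hP'' htop' hL one_pos hT₁ hfar' hL'
  -- ### back to `U`
  set lam : ℝ := min 1 L⁻¹ / 2 with hlamdef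
  have hlampos : 0 < lam := by rw [hlamdef]; exact div_pos (lt_min one_pos (inv_pos.2 hL)) two_pos
  have hmeas : AEStronglyMeasurable (uncurry U')
      (volume.restrict (parabolicCylinder lam (0 : ℝ × EuclideanSpace ℝ (Fin 3)))) := by
    have h := (hsw' lam hlampos).1.distributional.1.aestronglyMeasurable
    rw [coe_parabolicCylinderOpens] at h
    exact h
  have hae0 : ∀ᵐ z ∂(volume.restrict (parabolicCylinder lam (0 : ℝ × EuclideanSpace ℝ (Fin 3)))),
      uncurry U' z = 0 := by
    have h := (lintegral_eq_zero_iff' (hmeas.enorm.pow_const 3)).1 hzero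
    filter_upwards [h] with z hz
    have hz' : ‖uncurry U' z‖ₑ ^ (3 : ℕ) = 0 := hz
    simpa using hz'
  -- transport along `(s, y) ↦ (s, y - x)`
  have hQ : MeasurableSet (parabolicCylinder lam (0 : ℝ × EuclideanSpace ℝ (Fin 3))) :=
    measurableSet_Ioo.prod measurableSet_ball
  have h1 := ae_restrict_comp_translate (-x) hQ hae0
  rw [preimage_translate_parabolicCylinder x lam] at h1
  filter_upwards [h1] with z hz
  simpa [hU'def] using hz

/-- **The late sweep** (first half of stub Z1 `stub_lateBoundedLiouville`): under the extinct Type-I apex package at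
the origin and an a.e. bound `‖U‖ ≤ L` on the whole-space slab `]−T₁, 0[ × ℝ³` (`T₁ ≥ 2`, `L > 0`), `U = 0` a.e. on the
whole-space slab `]−(λ/2)², 0[ × ℝ³`, `λ = min(1, 1/L)` (a countable dense set of top apices and
`lateSweep_ae_zero_ball`). [cite: EscauriazaSereginSverak2003, Thm. 5.1] -/
theorem lateSweep_ae_zero
    {U : ℝ → EuclideanSpace ℝ (Fin 3) → EuclideanSpace ℝ (Fin 3)}
    {P : ℝ → EuclideanSpace ℝ (Fin 3) → ℝ}
    {G : ℝ → EuclideanSpace ℝ (Fin 3) → EuclideanSpace ℝ (Fin 3) →L[ℝ] EuclideanSpace ℝ (Fin 3)}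
    {M D₀ : ℝ≥0} {C : ℝ}
    (hsw : ∀ a : ℝ, 0 < a →
      IsSuitableWeakSolutionInBall a (0 : ℝ × EuclideanSpace ℝ (Fin 3)) U P)
    (hG : ∀ a : ℝ, 0 < a →
      HasWeakSpatialGradientOn
        (parabolicCylinderOpens a (0 : ℝ × EuclideanSpace ℝ (Fin 3))) U G)
    (hI : ∀ a : ℝ, 0 < a →
      typeIBound (parabolicCylinder a (0 : ℝ × EuclideanSpace ℝ (Fin 3))) U P G ≤ M)
    (hD : ∀ z₀ : ℝ × EuclideanSpace ℝ (Fin 3), z₀.1 ≤ 0 →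
      ∀ r : ℝ, 0 < r → cknD r z₀ P ≤ D₀)
    (hrate : ∀ s : ℝ, s < 0 →
      ∀ᵐ y : EuclideanSpace ℝ (Fin 3), ‖U s y‖ ≤ C / Real.sqrt (-s))
    (htop : ∀ φ : EuclideanSpace ℝ (Fin 3) → EuclideanSpace ℝ (Fin 3),
      ContDiff ℝ (⊤ : ℕ∞) φ →
      HasCompactSupport φ → ∀ ε : ℝ, 0 < ε →
      ∃ s₀ : ℝ, s₀ < 0 ∧ ∀ᵐ s ∂(volume.restrict (Ioo s₀ 0)), |∫ y, ⟪U s y, φ y⟫| ≤ ε)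
    {L T₁ : ℝ} (hL : 0 < L) (hT₁ : 2 ≤ T₁)
    (hbd : ∀ᵐ z ∂(volume.restrict (Ioo (-T₁) 0 ×ˢ (univ : Set (EuclideanSpace ℝ (Fin 3))))),
      ‖U z.1 z.2‖ ≤ L) :
    ∀ᵐ z ∂(volume.restrict
      (Ioo (-(min 1 L⁻¹ / 2) ^ 2) 0 ×ˢ (univ : Set (EuclideanSpace ℝ (Fin 3))))), U z.1 z.2 = 0 := by
  set lam : ℝ := min 1 L⁻¹ / 2 with hlamdef
  have hlampos : 0 < lam := by rw [hlamdef]; exact div_pos (lt_min one_pos (inv_pos.2 hL)) two_pos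
  obtain ⟨D, hDc, hDd⟩ := TopologicalSpace.exists_countable_dense (EuclideanSpace ℝ (Fin 3))
  have hcov : Ioo (-lam ^ 2) (0 : ℝ) ×ˢ (univ : Set (EuclideanSpace ℝ (Fin 3))) ⊆
      ⋃ x ∈ D, parabolicCylinder lam (((0 : ℝ), x) : ℝ × EuclideanSpace ℝ (Fin 3)) := by
    rintro ⟨s, y⟩ ⟨hs, -⟩
    obtain ⟨x, hxD, hxy⟩ := hDd.exists_dist_lt y hlampos
    refine mem_iUnion₂.2 ⟨x, hxD, ?_⟩
    rw [mem_parabolicCylinder]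
    exact ⟨⟨by simpa using hs.1, by simpa using hs.2⟩, by simpa using hxy⟩
  refine ae_restrict_of_ae_restrict_of_subset hcov ?_
  rw [ae_restrict_biUnion_iff _ hDc]
  intro x _
  exact lateSweep_ae_zero_ball hsw hG hI hD hrate htop hL hT₁ hbd x

end Summit.NavierStokesRegularity.NavierStokesRegularity.Theorems.TypeITraceScarL3

end
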